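import Mathlib.Algebra.Polynomial.Degree.Domain
import Literature.AlgebraicGeometry.Resolution.RegularSystemOfParameters
import Summits.ResolutionOfSingularities.ResolutionOfSingularities.Theorems.WeightedInvariantContactLevelQuotient
import HarnessLib

/-!
# Contact levels in dimension two: the two order computations behind the specimen «E2» (part 1 of 2)

Topic: `Summits/ResolutionOfSingularities/ResolutionOfSingularities/Theorems`. Helper for the door item
`HypersurfaceCentreConstruction` (statement `stmt-ResolutionOfSingularities-19897`, route `WeightedInvariant`), line
`local-engine` of res-L1-w43-plan-1 (L W4.3), regime P3 (positions of Krull dimension `3`): part 1 of the KERNEL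
CERTIFICATE of res-type-078's engine finding «E2» (`plan/tools/res-type-078/p3/IOTA3-INPUT.md` v1.1 §0 (v) / §7; CHAIN
w43 v4.19 §(2) FINDINGS OF RECORD; ORDER (o31) probe row `E2`) — the char-free DIM-3 STALL of the pair `(ord, b_max)`.
Part 2 (`…ContactLevelE2`) evaluates res-type-092's `Reaches` / `bMax` (`…ContactCentreFiltration`, ORDER (o24-D)) on
`x³ + y⁴z⁴ + y⁷` and on its `z`-chart strict transform `x³ + y⁴z² + y⁷z`; by the QUOTIENT METHOD (res-type-098's part 1
`…ContactLevelQuotient`, p527533: level `n` of the contact filtration of `g` maps into `𝔪̄ⁿ` of `S/(g)`, a regular local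
ring of dimension `2`) everything reduces to the two order computations of this file.

[OURS · L1 W4.3] Replaces the role of NO printed item; NOT a statement of the manuscript
[claim: Hironaka2017, status: under-review]. AI work, weaker than expert review. Numbers only — no word on the P3 design.

## Content (namespace `ContactLevelE2`)

In a regular local ring `T` of dimension `2` with `𝔪_T = (a, b, c)` (one redundant generator):
* `not_mem_pow_nine_origin : a³ + b⁴c⁴ + b⁷ ∉ 𝔪⁹` — valuation property of `ord` (`ord a³ = 3 · ord a ≠ 7 = ord b⁴(b³ + c⁴)`
  when `a ∈ 𝔪²`, order `3` otherwise).
* `not_mem_pow_seven_of_mem_sq : a ∈ 𝔪², 𝔪 = (b, c) ⇒ a³ + b⁴c² ∉ 𝔪⁷` — **the tie-breaker**: an order-`6` TIE `a³` vs `b⁴c²`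
  occurs when `ord a = 2`; it is broken by QUASI-REGULARITY of the regular system `(c, b)` (Matsumura 17.10, the tree's
  `coeff_mem_maximalIdeal_of_eval_mem_pow`): `a = G(c, b)` for a quadratic form `G` over `T`, and `Ḡ³ + C²B⁴ = 0` in
  `κ[C, B]` is impossible — substitute `C = U³`, `B = U`: `q³ = −U¹⁰`, `3 · deg q = 10`.
* `not_mem_pow_nine_chart : a³ + b⁴c² + b⁷c ∉ 𝔪⁹` (order `3` if `a ∉ 𝔪²`, else the tie-breaker and `b⁷c ∈ 𝔪⁸`).
* bookkeeping: `not_mem_sq_of_span_triple_eq`, `not_mem_sq_of_span_pair_eq`, `span_pair_eq_of_mem_sq_head`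
  (corollaries of `ContactLevel.not_mem_sq_of_span_insert_eq` / Nakayama), `isRegularLocalRing_quotient_and_ringKrullDim_eq_two`
  (Matsumura 14.2 via `IsRegularLocalRing.quotient_span_singleton`), `three_mul_ne_seven`, `range_vec₂`.

## References

* H. Matsumura, *Commutative Ring Theory* (1986), Thm. 14.2, Thm. 17.10. [Matsumura1987]
* O. Zariski, P. Samuel, *Commutative Algebra* II, Ch. VIII §1 (the order valuation). [ZariskiSamuel1960]
* res-type-078 `IOTA3-INPUT.md` v1.1 §7 (E2) (hand facts); res-type-098 STATUS 2026-08-27T11:07:40Z / 11:27:52Z (quotient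
  method, part 1 p527533); res-L1-w43-plan-1 CHAIN w43 v4.19 (OURS, AI planning / hand computations).
-/

noncomputable section

open IsLocalRing MvPolynomial Literature.AlgebraicGeometry.Resolution
open Summit.ResolutionOfSingularities.ResolutionOfSingularities.Cruxes.HypersurfaceCentreConstruction.LocalEngine
open Summit.ResolutionOfSingularities.ResolutionOfSingularities.Theorems.ContactLevel

set_option linter.dupNamespace false -- mandated namespace of this single-conjunct summit

namespace Summit.ResolutionOfSingularities.ResolutionOfSingularities.Theorems.ContactLevelE2

universe u

/-! ## §1 Bookkeeping (corollaries of `…ContactLevelQuotient`) -/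

section Tools

variable {T : Type u} [CommRing T]

/-- In dimension `3` with `𝔪 = (a, b, c)`: `a ∉ 𝔪²`. [cite: Matsumura1987, Thm. 14.2] -/
theorem not_mem_sq_of_span_triple_eq [IsLocalRing T] [IsNoetherianRing T] {a b c : T}
    (h : Ideal.span {a, b, c} = maximalIdeal T) (hdim : ringKrullDim T = 3) : a ∉ maximalIdeal T ^ 2 := by
  refine not_mem_sq_of_span_insert_eq (s := {b, c}) (Set.toFinite _) h ?_
  rw [hdim]
  have : ({b, c} : Set T).ncard ≤ 2 := (Set.ncard_insert_le b {c}).trans (by rw [Set.ncard_singleton])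
  calc ((({b, c} : Set T).ncard : ℕ) : WithBot ℕ∞) ≤ ((2 : ℕ) : WithBot ℕ∞) := by exact_mod_cast this
    _ < 3 := by exact_mod_cast (by norm_num : (2 : ℕ) < 3)

/-- In dimension `2` with `𝔪 = (a, b)`: `a ∉ 𝔪²`. [cite: Matsumura1987, Thm. 14.2] -/
theorem not_mem_sq_of_span_pair_eq [IsLocalRing T] [IsNoetherianRing T] {a b : T}
    (h : Ideal.span {a, b} = maximalIdeal T) (hdim : ringKrullDim T = 2) : a ∉ maximalIdeal T ^ 2 := by
  refine not_mem_sq_of_span_insert_eq (s := {b}) (Set.toFinite _) h ?_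
  rw [hdim, Set.ncard_singleton]
  exact_mod_cast (by norm_num : (1 : ℕ) < 2)

/-- If `𝔪 = (a, b, c)` and the HEAD generator `a ∈ 𝔪²` then `𝔪 = (b, c)` (Nakayama; `ContactLevel.span_pair_eq_of_mem_sq`
removes the last generator). [cite: Matsumura1987, Thm. 2.2] -/
theorem span_pair_eq_of_mem_sq_head [IsLocalRing T] [IsNoetherianRing T] {a b c : T}
    (h : Ideal.span {a, b, c} = maximalIdeal T) (ha : a ∈ maximalIdeal T ^ 2) :
    Ideal.span {b, c} = maximalIdeal T := by
  refine span_eq_maximalIdeal_of_le_sup_sq ?_ ?_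
  · rw [← h]
    exact Ideal.span_mono (Set.subset_insert _ _)
  · calc maximalIdeal T = Ideal.span {a} ⊔ Ideal.span {b, c} := by rw [← Ideal.span_insert, h]
      _ ≤ Ideal.span {b, c} ⊔ maximalIdeal T ^ 2 :=
        sup_le (((Ideal.span_singleton_le_iff_mem _).mpr ha).trans le_sup_right) le_sup_left

variable {S : Type u} [CommRing S]

/-- For a regular parameter `g` of a regular local ring `S` of dimension `3`, `S/(g)` is a regular local ring of
dimension `2` (Matsumura 14.2, the tree's `IsRegularLocalRing.quotient_span_singleton`). [cite: Matsumura1987, Thm. 14.2] -/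
theorem isRegularLocalRing_quotient_and_ringKrullDim_eq_two [IsRegularLocalRing S] (hdim : ringKrullDim S = 3)
    {g : S} (hg : g ∈ maximalIdeal S) (hg2 : g ∉ maximalIdeal S ^ 2) :
    IsRegularLocalRing (S ⧸ Ideal.span {g}) ∧ ringKrullDim (S ⧸ Ideal.span {g}) = 2 := by
  obtain ⟨hT, hdimT⟩ := IsRegularLocalRing.quotient_span_singleton hg hg2
  refine ⟨hT, ?_⟩
  haveI := hT
  obtain ⟨n, hn⟩ := exists_nat_cast_eq_ringKrullDim (R := S ⧸ Ideal.span {g})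
  rw [hn, hdim] at hdimT
  have h3 : n + 1 = 3 := by exact_mod_cast hdimT
  have h2 : n = 2 := by omega
  rw [hn, h2]
  rfl

end Tools

/-! ## §2 Two order computations in a regular local ring of dimension two -/

section DimTwo

variable {T : Type u} [CommRing T] [IsRegularLocalRing T]

/-- `3 · e ≠ 7` in `ℕ∞`. [folklore] -/
theorem three_mul_ne_seven (e : ℕ∞) : (3 : ℕ∞) * e ≠ 7 := by
  rcases eq_or_ne e ⊤ with rfl | htop
  · rw [ENat.mul_top (by norm_num)]
    exact ENat.top_ne_coe 7
  · obtain ⟨n, rfl⟩ := ENat.ne_top_iff_exists.mp htop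
    intro h
    have h' : 3 * n = 7 := by exact_mod_cast h
    omega

/-- **The origin shape in dimension two**: in a regular local ring `T` of dimension `2` with `𝔪 = (a, b, c)`,
`a³ + b⁴c⁴ + b⁷ ∉ 𝔪⁹`.  If `a ∉ 𝔪²` the order is `3`.  If `a ∈ 𝔪²` then `(b, c)` is a regular system of parameters,
`ord b⁴(b³ + c⁴) = 4 + 3 = 7`, and `ord a³ = 3 · ord a ≠ 7`, so the order of the sum is `min (3 · ord a, 7) ≤ 7`.
[cite: ZariskiSamuel1960, Ch. VIII §1 Thm. 1] -/
theorem not_mem_pow_nine_origin (hdim : ringKrullDim T = 2) {a b c : T}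
    (h : Ideal.span {a, b, c} = maximalIdeal T) : a ^ 3 + b ^ 4 * c ^ 4 + b ^ 7 ∉ maximalIdeal T ^ 9 := by
  have ha : a ∈ maximalIdeal T := h ▸ Ideal.subset_span (by simp)
  have hb : b ∈ maximalIdeal T := h ▸ Ideal.subset_span (by simp)
  have hc : c ∈ maximalIdeal T := h ▸ Ideal.subset_span (by simp)
  have htail : b ^ 4 * c ^ 4 + b ^ 7 ∈ maximalIdeal T ^ 7 := by
    refine add_mem ?_ (Ideal.pow_mem_pow hb 7)
    have : b ^ 4 * c ^ 4 ∈ maximalIdeal T ^ 8 := by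
      rw [show (8 : ℕ) = 4 + 4 from rfl, pow_add]
      exact Ideal.mul_mem_mul (Ideal.pow_mem_pow hb 4) (Ideal.pow_mem_pow hc 4)
    exact Ideal.pow_le_pow_right (by norm_num) this
  have htail' : (7 : ℕ∞) ≤ adicOrder (b ^ 4 * c ^ 4 + b ^ 7) := by
    exact_mod_cast (le_adicOrder_iff _ 7).mpr htail
  show a ^ 3 + b ^ 4 * c ^ 4 + b ^ 7 ∉ maximalIdeal T ^ (8 + 1)
  rw [← adicOrder_lt_iff]
  by_cases ha2 : a ∈ maximalIdeal T ^ 2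
  · -- `(b, c)` is a regular system of parameters
    have hbc : Ideal.span {b, c} = maximalIdeal T := span_pair_eq_of_mem_sq_head h ha2
    have hb2 : b ∉ maximalIdeal T ^ 2 := not_mem_sq_of_span_pair_eq hbc hdim
    have hc2 : c ∉ maximalIdeal T ^ 2 :=
      not_mem_sq_of_span_pair_eq (by rwa [Set.pair_comm] at hbc) hdim
    have h7 : adicOrder (b ^ 4 * c ^ 4 + b ^ 7) = 7 := by
      have h3 : adicOrder (b ^ 3) = 3 := adicOrder_pow_of_not_mem_sq hb hb2 3
      have h4 : adicOrder (c ^ 4) = 4 := adicOrder_pow_of_not_mem_sq hc hc2 4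
      have hin : adicOrder (b ^ 3 + c ^ 4) = 3 := by
        rw [adicOrder_add_eq_left_of_lt (by rw [h3, h4]; exact_mod_cast (by norm_num : (3 : ℕ) < 4)), h3]
      rw [show b ^ 4 * c ^ 4 + b ^ 7 = b ^ 4 * (b ^ 3 + c ^ 4) by ring, adicOrder_mul,
        adicOrder_pow_of_not_mem_sq hb hb2 4, hin]
      rfl
    have hne : adicOrder (a ^ 3) ≠ 7 := by
      rw [adicOrder_pow]
      exact three_mul_ne_seven _
    rcases lt_or_gt_of_ne hne with hlt | hgt
    · rw [add_assoc, adicOrder_add_eq_left_of_lt (by rwa [h7])]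
      exact hlt.trans (by exact_mod_cast (by norm_num : (7 : ℕ) < 9))
    · rw [add_assoc, add_comm, adicOrder_add_eq_left_of_lt (by rwa [h7]), h7]
      exact_mod_cast (by norm_num : (7 : ℕ) < 9)
  · -- `a` is a regular parameter: order `3`
    have h3 : adicOrder (a ^ 3) = 3 := adicOrder_pow_of_not_mem_sq ha ha2 3
    have hlt : adicOrder (a ^ 3) < adicOrder (b ^ 4 * c ^ 4 + b ^ 7) := by
      rw [h3]
      exact lt_of_lt_of_le (by exact_mod_cast (by norm_num : (3 : ℕ) < 7)) htail'
    rw [add_assoc, adicOrder_add_eq_left_of_lt hlt, h3]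
    exact_mod_cast (by norm_num : (3 : ℕ) < 9)

omit [CommRing T] [IsRegularLocalRing T] in
/-- `Set.range ![c, b] = {c, b}`. [folklore] -/
theorem range_vec₂ (c b : T) : Set.range ![c, b] = {c, b} := by
  ext t
  simp only [Set.mem_range, Fin.exists_fin_two, Matrix.cons_val_zero, Matrix.cons_val_one,
    Set.mem_insert_iff, Set.mem_singleton_iff]
  constructor
  · rintro (h | h)
    · exact Or.inl h.symm
    · exact Or.inr h.symm
  · rintro (h | h)
    · exact Or.inl h.symm
    · exact Or.inr h.symm

/-- **The tie-breaker** (quasi-regularity, Matsumura 17.10): in a regular local ring `T` of dimension `2` with regular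
system of parameters `(c, b)` — `𝔪 = (b, c)` — and ANY `a ∈ 𝔪²`: `a³ + b⁴c² ∉ 𝔪⁷`.  Write `a = G(c, b)` with `G` a
quadratic form over `T`; if `G³ + C²B⁴` (a form of degree `6`) evaluated into `𝔪⁷`, all its coefficients would lie in
`𝔪`, i.e. `Ḡ³ = −C²B⁴` in `κ[C, B]`; substituting `C = U³`, `B = U` gives `q³ = −U¹⁰` in `κ[U]`, `3 · deg q = 10`.
[cite: Matsumura1987, Thm. 17.10] -/
theorem not_mem_pow_seven_of_mem_sq (hdim : ringKrullDim T = 2) {a b c : T}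
    (hbc : Ideal.span {b, c} = maximalIdeal T) (ha : a ∈ maximalIdeal T ^ 2) :
    a ^ 3 + b ^ 4 * c ^ 2 ∉ maximalIdeal T ^ 7 := by
  intro hmem
  -- the regular system of parameters `v = (c, b)`
  have hd : (maximalIdeal T).spanFinrank = 2 := by
    have := IsRegularLocalRing.spanFinrank_maximalIdeal (R := T)
    rw [hdim] at this
    exact_mod_cast this
  set v : Fin 2 → T := ![c, b] with hv_def
  have hv : Ideal.span (Set.range v) = maximalIdeal T := by
    rw [hv_def, range_vec₂, Set.pair_comm, hbc]
  -- `a = G(v)` with `G` a quadratic form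
  obtain ⟨G, hG, hGa⟩ := exists_isHomogeneous_of_mem_span_pow v 2 (y := a) (by rw [hv]; exact ha)
  -- the degree-6 form `F = G³ + X₀² X₁⁴` evaluates to `a³ + c² b⁴ ∈ 𝔪⁷`
  have hF : (G ^ 3 + X 0 ^ 2 * X 1 ^ 4 : MvPolynomial (Fin 2) T).IsHomogeneous 6 :=
    (hG.pow 3).add (((isHomogeneous_X T 0).pow 2).mul ((isHomogeneous_X T 1).pow 4))
  have hv0 : v 0 = c := rfl
  have hv1 : v 1 = b := rfl
  have heval : eval v (G ^ 3 + X 0 ^ 2 * X 1 ^ 4) = a ^ 3 + b ^ 4 * c ^ 2 := by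
    simp only [map_add, map_pow, map_mul, eval_X, hGa, hv0, hv1]
    ring
  have h7 : eval v (G ^ 3 + X 0 ^ 2 * X 1 ^ 4) ∈ maximalIdeal T ^ (6 + 1) := by
    rw [heval]
    exact hmem
  have hcoef : ∀ m, ((G ^ 3 + X 0 ^ 2 * X 1 ^ 4 : MvPolynomial (Fin 2) T)).coeff m ∈ maximalIdeal T :=
    fun m => coeff_mem_maximalIdeal_of_eval_mem_pow hd v hv hF h7 m
  -- reduce modulo `𝔪`: `Ḡ³ + X₀² X₁⁴ = 0` in `κ[X₀, X₁]`
  have hmap : MvPolynomial.map (residue T) (G ^ 3 + X 0 ^ 2 * X 1 ^ 4) = 0 := by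
    ext m
    rw [coeff_map, coeff_zero, residue_eq_zero_iff]
    exact hcoef m
  have hQ : (MvPolynomial.map (residue T) G) ^ 3 + X 0 ^ 2 * X 1 ^ 4 = 0 := by
    simpa only [map_add, map_pow, map_mul, map_X] using hmap
  -- substitute `X₀ = U³`, `X₁ = U`
  set φ := MvPolynomial.aeval (R := ResidueField T)
    (![(Polynomial.X : Polynomial (ResidueField T)) ^ 3, Polynomial.X]) with hφ_def
  have hq : (φ (MvPolynomial.map (residue T) G)) ^ 3 + (Polynomial.X ^ 3) ^ 2 * Polynomial.X ^ 4 = 0 := by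
    have := congrArg φ hQ
    simpa only [map_add, map_pow, map_mul, hφ_def, aeval_X, Matrix.cons_val_zero, Matrix.cons_val_one,
      map_zero] using this
  have hq' : (φ (MvPolynomial.map (residue T) G)) ^ 3 = -((Polynomial.X : Polynomial (ResidueField T)) ^ 10) := by
    rw [eq_neg_iff_add_eq_zero, ← hq]
    ring
  have hdeg := congrArg Polynomial.natDegree hq'
  rw [Polynomial.natDegree_pow, Polynomial.natDegree_neg, Polynomial.natDegree_X_pow] at hdeg
  omega

/-- **The chart shape in dimension two**: in a regular local ring `T` of dimension `2` with `𝔪 = (a, b, c)`,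
`a³ + b⁴c² + b⁷c ∉ 𝔪⁹`.  If `a ∉ 𝔪²` the order is `3`; if `a ∈ 𝔪²`, `(b, c)` is a regular system of parameters and
`a³ + b⁴c² ∉ 𝔪⁷` (`not_mem_pow_seven_of_mem_sq`) while `b⁷c ∈ 𝔪⁸`. [cite: Matsumura1987, Thm. 17.10] -/
theorem not_mem_pow_nine_chart (hdim : ringKrullDim T = 2) {a b c : T}
    (h : Ideal.span {a, b, c} = maximalIdeal T) : a ^ 3 + b ^ 4 * c ^ 2 + b ^ 7 * c ∉ maximalIdeal T ^ 9 := by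
  have ha : a ∈ maximalIdeal T := h ▸ Ideal.subset_span (by simp)
  have hb : b ∈ maximalIdeal T := h ▸ Ideal.subset_span (by simp)
  have hc : c ∈ maximalIdeal T := h ▸ Ideal.subset_span (by simp)
  have h8 : b ^ 7 * c ∈ maximalIdeal T ^ 8 := by
    rw [show (8 : ℕ) = 7 + 1 from rfl, pow_add, pow_one]
    exact Ideal.mul_mem_mul (Ideal.pow_mem_pow hb 7) hc
  by_cases ha2 : a ∈ maximalIdeal T ^ 2
  · intro hmem
    have hbc : Ideal.span {b, c} = maximalIdeal T := span_pair_eq_of_mem_sq_head h ha2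
    refine not_mem_pow_seven_of_mem_sq hdim hbc ha2 ?_
    have : a ^ 3 + b ^ 4 * c ^ 2 = (a ^ 3 + b ^ 4 * c ^ 2 + b ^ 7 * c) - b ^ 7 * c := by ring
    rw [this]
    exact sub_mem (Ideal.pow_le_pow_right (by norm_num) hmem) (Ideal.pow_le_pow_right (by norm_num) h8)
  · have htail : b ^ 4 * c ^ 2 + b ^ 7 * c ∈ maximalIdeal T ^ 6 := by
      refine add_mem ?_ (Ideal.pow_le_pow_right (by norm_num) h8)
      rw [show (6 : ℕ) = 4 + 2 from rfl, pow_add]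
      exact Ideal.mul_mem_mul (Ideal.pow_mem_pow hb 4) (Ideal.pow_mem_pow hc 2)
    have htail' : (6 : ℕ∞) ≤ adicOrder (b ^ 4 * c ^ 2 + b ^ 7 * c) := by
      exact_mod_cast (le_adicOrder_iff _ 6).mpr htail
    have h3 : adicOrder (a ^ 3) = 3 := adicOrder_pow_of_not_mem_sq ha ha2 3
    have hlt : adicOrder (a ^ 3) < adicOrder (b ^ 4 * c ^ 2 + b ^ 7 * c) := by
      rw [h3]
      exact lt_of_lt_of_le (by exact_mod_cast (by norm_num : (3 : ℕ) < 6)) htail'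
    show a ^ 3 + b ^ 4 * c ^ 2 + b ^ 7 * c ∉ maximalIdeal T ^ (8 + 1)
    rw [← adicOrder_lt_iff, add_assoc, adicOrder_add_eq_left_of_lt hlt, h3]
    exact_mod_cast (by norm_num : (3 : ℕ) < 9)

end DimTwo

end Summit.ResolutionOfSingularities.ResolutionOfSingularities.Theorems.ContactLevelE2

end
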